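import Literature.Computability.QuantumComplexity.HidingErrorNumerics
import Literature.Computability.QuantumComplexity.RoundedGaussianRangeTail
import Literature.Computability.QuantumComplexity.ApproxBosonSamplingMachines
import Literature.Computability.Complexity.StockmeyerMachines
import Literature.Computability.QuantumComplexity.BosonSamplingMainTheorem
import HarnessLib

/-!
# Proof of AA13 Thm. 1.3: `|GPE|²_± ∈ FBPP^{NP^𝒪}` for every approximate BosonSampling oracle `𝒪`

Family `quantum-advantage`. This file DISCHARGES the named fact
`gpeSolvableInFBPPRel_NPRel_of_approxBosonSamplingOracle` (Aaronson–Arkhipov, *The computational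
complexity of linear optics*, Thm. 1.3): for every oracle `𝒪` meeting Def. 3.11 (a black-box
approximate BosonSampler with its own coins), the Gaussian permanent estimation problem `|GPE|²_±`
is solved, jointly over the Gaussian input and the coins, by a polynomial-time oracle transducer
relative to an `NP^𝒪` language.

The machine (`gpeSolver hidH p₀ c_𝒪 c_S F`, `HidingSolver.lean`) follows §5.2 with one deviation
in the hiding step, spelled out in `HidingProgram.lean`: instead of sampling a Haar unitary and
postselecting (Lemma 5.8, whose printed form is not finite-precision), it plants the rounded input
`X̃` at random rows of a coin-sampled pseudo-Gaussian integer array, orthonormalises EXACTLY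
(integer Gram–Schmidt, `GramSchmidtRounding.lean`), queries `𝒪` on the rounded unit matrix, and
estimates the planted outcome's probability with Stockmeyer's counter (Thm. 4.1,
`stockmeyerApproxCounting_holds`) — AA13 themselves remark that "the hiding procedure could be
implemented in BPP" (after Lemma 5.8). The probabilistic analysis is the chain

  real Gaussian input ⟶ (domination, `RoundedGaussianDomination`) coin-sampled input ⟶ (symmetry,
  `HidingRealToIdeal`) uniform array independent of the planted position ⟶ (union bound,
  `HidingGoodEvent`) six small events ⟶ (deterministic core, `HidingIdealCore`) accuracy,

with the numbers of `HidingParameters` / `HidingSamplerNumerics` / `HidingErrorNumerics`: the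
failure probability is at most `14δ/16 < δ`.

* `gpeBadEv_subset` — failure comes from a large entry of `X` or from the machine on the rounded input;
* `sum_gpeBadEv_le` — the failure bound for `n ≥ 1`;
* `gpeBadEv_dim_zero` — in dimension `0` the machine answers `4ᵇ` (`|Per ∅|² = 1`) and never fails;
* **`gpeSolvableInFBPPRel_NPRel_of_approxBosonSamplingOracle_holds`**.

All proved, no new named facts.

## References

* S. Aaronson, A. Arkhipov, *The computational complexity of linear optics*, Theory of Computing 9
  (2013) 143–252 (arXiv:1011.3245), Thm. 1.3 (p. 152; proof §5.2, pp. 192–195), Def. 3.11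
  (p. 174), Thm. 4.1 (p. 175), Lemma 5.8 and the remark following it (p. 191), §2 (p. 161,
  finite precision).
-/

noncomputable section

namespace Literature.Computability.QuantumComplexity

open MeasureTheory Finset Matrix Real Polynomial Literature.Computability.Complexity Literature.Computability.Complexity.CodeFP
  Literature.Computability.Cryptography Literature.Probability.Distributions Literature.Probability.Moments
  Literature.LinearAlgebra.Matrix Literature.Analysis.Matrix Literature.Combinatorics.Enumerative

/-! ### Bookkeeping -/

/-- Sums over coin strings depend only on the length. [folklore] -/
theorem sum_coins_congr_len {a b : ℕ} (h : a = b) (g : List Bool → ℝ) :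
    ∑ v : List.Vector Bool a, g v.toList = ∑ v : List.Vector Bool b, g v.toList := by
  subst h; rfl

/-- Counts over coin strings depend only on the length. [folklore] -/
theorem card_filter_prod_coins_congr {α : Type*} [Fintype α] {a b : ℕ} (h : a = b) (Q : α → List Bool → Prop)
    [∀ x l, Decidable (Q x l)] :
    (univ.filter fun q : α × List.Vector Bool a => Q q.1 q.2.toList).card =
      (univ.filter fun q : α × List.Vector Bool b => Q q.1 q.2.toList).card := by
  subst h; rfl

/-- `|A|^{n²} = 2^{n(n·2L_c)}` for the entry alphabet. [folklore] -/
theorem card_entryBlock_pow (P : PGParams) (n : ℕ) :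
    (Fintype.card (EntryBlock P) : ℝ) ^ (n * n) = 2 ^ (n * (n * (2 * P.coinLen))) := by
  rw [card_entryBlock, ← pow_mul]
  congr 1; ring

/-- **The ideal sample space has `2^{|r|}` points**: `#Ω = mⁿ · |A|^{mn} · 2^{LU} = 2^{nμ + m n 2L_c + LU}`
for `m = n + e = 2^μ`. [folklore] -/
theorem card_idealΩ (IP : IdealParams) (P : PGParams) {n e μ : ℕ} (hm : n + e = 2 ^ μ) :
    (Fintype.card (IdealΩ IP P n e) : ℝ) = 2 ^ (n * μ + (n + e) * (n * (2 * P.coinLen)) + IP.ℓ₂) := by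
  simp only [IdealΩ, Fintype.card_prod, Fintype.card_fun, Fintype.card_fin, card_vector, Fintype.card_bool]
  rw [hm]
  push_cast
  rw [← pow_mul, ← pow_mul, ← pow_mul, ← pow_add, ← pow_add]
  congr 1
  ring

/-! ### The failure event of `|GPE|²_±` and its two sources -/

section Main

variable (p₀ cO cS : Polynomial ℕ) (F : List Bool → List Bool) (O : Oracle)

/-- The failure event of `GPERandOracleSolves` at `(X, r)` for the machine: the answer read as
`z/4ᵇ` misses `|Per X|²` by more than `n!/kε`. [cite: AaronsonArkhipovToC2013, Problem 1.2 (p. 152)] -/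
def GPEBadEv (n kε kδ N : ℕ) (X : Fin n → Fin n → ℂ) (r : List Bool) : Prop :=
  (n.factorial : ℝ) / kε <
    |(GPERandOracleEstimate (gpeSolver hidH p₀ cO cS F) n (precP.eval N) kε kδ
          (roundMatrix (precP.eval N) (Matrix.of X)) r : ℝ) / 4 ^ (precP.eval N) -
        ‖(Matrix.of X).permanent‖ ^ 2|

/-- **The two sources of failure**: a large entry of `X` (then the rounding of the permanent is not
controlled) or the failure of the machine on the rounded input (`FailEv`). [cite: AaronsonArkhipovToC2013, proof of Thm. 1.3, eq. (5.96) (p. 195) with §2 (p. 161)] -/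
theorem gpeBadEv_subset {n kε kδ N : ℕ} (H : HidingHyp n kε kδ N) (r : List Bool) :
    {X | GPEBadEv p₀ cO cS F n kε kδ N X r} ⊆
      {X | ∃ i j, 2 * (N : ℝ) < ‖X i j‖} ∪
        {X | FailEv hidH p₀ cO cS F n (precP.eval N) kε kδ (roundedInput (precP.eval N) X) r} := by
  intro X hX
  simp only [Set.mem_setOf_eq, Set.mem_union] at hX ⊢
  by_contra h
  simp only [not_or, not_exists, not_lt] at h
  obtain ⟨hsmall, hfail⟩ := h
  simp only [FailEv, not_lt] at hfail
  -- the rounding of the permanent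
  have hround := abs_norm_sq_permanent_sub_rounded_le (precP.eval N) X (L := 2 * (N : ℝ))
    (by have := H.N_real; linarith) hsmall
  have hr := H.rounding_le
  -- the machine's answer
  simp only [GPEBadEv] at hX
  rw [gpeRandOracleEstimate_gpeSolver] at hX
  have hrows : rowsOf (roundMatrix (precP.eval N) (Matrix.of X)) = rowsOf (roundedInput (precP.eval N) X) := rfl
  rw [hrows] at hX
  have htri := abs_sub_le
    ((postFun hidH p₀ cO (((n, precP.eval N, kε, kδ, rowsOf (roundedInput (precP.eval N) X)), r),
        F (preFun hidH p₀ cO cS ((n, precP.eval N, kε, kδ, rowsOf (roundedInput (precP.eval N) X)), r))) : ℝ) /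
      4 ^ precP.eval N)
    (‖(Matrix.of fun i j => dyadicComplex (precP.eval N) (roundedInput (precP.eval N) X i j)).permanent‖ ^ 2)
    (‖(Matrix.of X).permanent‖ ^ 2)
  have h2 : |‖(Matrix.of fun i j => dyadicComplex (precP.eval N) (roundedInput (precP.eval N) X i j)).permanent‖ ^ 2 -
      ‖(Matrix.of X).permanent‖ ^ 2| ≤ (n.factorial : ℝ) / (2 * kε) := by
    rw [abs_sub_comm]; exact hround.trans hr
  have : (n.factorial : ℝ) / (2 * kε) + (n.factorial : ℝ) / (2 * kε) = (n.factorial : ℝ) / kε := by ring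
  linarith

/-- **The failure bound for `n ≥ 1`:** summed over the coin strings of length `|r| = coinP(N)`,
the Gaussian probability of failure is at most `(14/16)·δ · 2^{|r|}` — entry tail `δ/16`, range
tail `δ/16`, and `F^{2n²} ≤ 2` times the six-term union bound `6δ/16`.
[cite: AaronsonArkhipovToC2013, proof of Thm. 1.3, eqs. (5.96)–(5.97) (p. 195)] -/
theorem sum_gpeBadEv_le (hO' : ∀ (n e b k : ℕ) (U : Matrix (Fin (n + e)) (Fin n) ℂ),
      IsColumnOrthonormal U → 0 < k → p₀.eval (n + e + k) ≤ b →
        (oracleSamplePMF O cO (encodingBosonInput.encode ⟨n, e, b, roundEntries b U⟩) k).tvDist (bosonTargetPMF U) ≤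
          1 / (k : ℝ))
    (hS : ∀ (x : List Bool) (m kη kδ : ℕ), 0 < kη → 0 < kδ →
      uniformProb (cS.eval (x.length + m + kη + kδ))
        {u | ¬ IsApproxCount kη (countWitnesses (samplerRel (oracleRandAlg O cO)) m x) (countEstimate F x m kη kδ u)} ≤
          1 / (kδ : ℝ))
    {n kε kδ N : ℕ} (H : HidingHyp n kε kδ N) :
    (∑ r : List.Vector Bool ((coinP p₀ cO cS).eval N),
        (gaussianMatrixMeasure n).real {X | GPEBadEv p₀ cO cS F n kε kδ N X r.toList}) ≤
      14 / (16 * (kδ : ℝ)) * 2 ^ ((coinP p₀ cO cS).eval N) := by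
  classical
  -- the parameters
  have hn := H.hn
  have hN1 : 1 ≤ N := by have := H.three_le_N; omega
  have hnN := H.n_le_N
  obtain ⟨hLr, hLU, hNr, hbr⟩ := coin_fields (p₀ := p₀) (cO := cO) (cS := cS) hnN
  have he := hidH_m_eq hnN
  have hm2 : n + (hidH.m N - n) = 2 ^ hidH.μ N := by rw [← he]; rfl
  haveI : NeZero (n + (hidH.m N - n)) := ⟨by rw [← he]; have := (le_hidH_m N).1; omega⟩
  have hne : 3 * n ^ 2 ≤ n + (hidH.m N - n) := three_mul_sq_le hnN
  rw [he] at hLr hLU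
  -- Step 1: the two sources, per coin string
  have hstep1 : (∑ r : List.Vector Bool ((coinP p₀ cO cS).eval N),
        (gaussianMatrixMeasure n).real {X | GPEBadEv p₀ cO cS F n kε kδ N X r.toList}) ≤
      2 ^ ((coinP p₀ cO cS).eval N) * (gaussianMatrixMeasure n).real {X | ∃ i j, 2 * (N : ℝ) < ‖X i j‖} +
        ∑ r : List.Vector Bool ((coinP p₀ cO cS).eval N), (gaussianMatrixMeasure n).real
          {X | FailEv hidH p₀ cO cS F n (precP.eval N) kε kδ (roundedInput (precP.eval N) X) r.toList} := by
    refine (Finset.sum_le_sum fun r _ =>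
      (measureReal_mono (gpeBadEv_subset p₀ cO cS F H r.toList)).trans (measureReal_union_le _ _)).trans ?_
    rw [Finset.sum_add_distrib, Finset.sum_const, card_univ, card_vector, Fintype.card_bool, nsmul_eq_mul]
    push_cast
    rfl
  refine hstep1.trans ?_
  -- Step 2: the entry tail
  have htail1 : (gaussianMatrixMeasure n).real {X | ∃ i j, 2 * (N : ℝ) < ‖X i j‖} ≤ 1 / (16 * (kδ : ℝ)) :=
    (real_exists_entry_norm_gt_le (by have := H.N_real; positivity)).trans H.entry_tail_le
  -- Step 3: domination (real to coin-sampled input), over the split coin length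
  have hdom := sum_real_roundEvent_le (sP N) (n := n)
    (L := n * hidH.μ N + (n + (hidH.m N - n)) * (n * (2 * (sP N).coinLen)) +
      ((coinP p₀ cO cS).eval N - (n * hidH.μ N + (n + (hidH.m N - n)) * (n * (2 * (sP N).coinLen)))))
    (fun x r => FailEv hidH p₀ cO cS F n (precP.eval N) kε kδ x r) (domF_nonneg hN1)
    (fun j hj => gaussBox_le_domF_mul_law hN1 hj)
  have hPb : (sP N).b = precP.eval N := rfl
  rw [hPb] at hdom
  rw [sum_coins_congr_len hLr (fun r => (gaussianMatrixMeasure n).real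
    {X | FailEv hidH p₀ cO cS F n (precP.eval N) kε kδ (roundedInput (precP.eval N) X) r})] at hdom
  rw [card_filter_prod_coins_congr hLr (fun x l => FailEv hidH p₀ cO cS F n (precP.eval N) kε kδ (rowsOfCoins (sP N) x) l)] at hdom
  rw [hLr] at hdom
  have htail2 : (gaussianMatrixMeasure n).real {X | ¬ InRange (sP N).T (roundedInput (precP.eval N) X)} ≤ 1 / (16 * (kδ : ℝ)) :=
    (real_not_inRange_le (precP.eval N) (Nat.one_le_iff_ne_zero.2 (sP N).T_pos.ne')).trans H.range_tail_le
  -- Step 4: the count on the coin-sampled side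
  have hcount : domF N ^ (2 * (n * n)) / 2 ^ (n * (n * (2 * (sP N).coinLen))) *
      ((univ.filter fun q : List.Vector Bool (n * (n * (2 * (sP N).coinLen))) × List.Vector Bool ((coinP p₀ cO cS).eval N) =>
        FailEv hidH p₀ cO cS F n (precP.eval N) kε kδ (rowsOfCoins (sP N) q.1) q.2.toList).card : ℝ) ≤
      12 / (16 * (kδ : ℝ)) * 2 ^ ((coinP p₀ cO cS).eval N) := by
    -- the ideal parameters
    let IP : IdealParams := idealP hidH p₀ cO cS F O N
      ((coinP p₀ cO cS).eval N - (n * hidH.μ N + (n + (hidH.m N - n)) * (n * (2 * (sP N).coinLen))))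
    have hsc := H.side_conditions
    obtain ⟨hε₀, hδ₀⟩ := H.ε₀_pos
    have hs := H.s_pos
    have hM4le := sum_unifW_mul_norm_yOf_pow_four_le (sP N)
    -- the oracle on Gram-good arrays
    have hO : ∀ W : Fin (n + (hidH.m N - n)) → Fin n → EntryBlock (sP N),
        GramGood (sP N) (gramTol N) (2 * 4 ^ (sP N).b * (sP N).v) W →
        (lawArr (sP N) IP W).tvDist (bosonTargetPMF (uMat (sP N) W)) ≤ oracleEps N * oracleDelta kδ / 24 := by
      intro W hG
      have hN₀ : 0 < ((n + (hidH.m N - n) : ℕ) : ℝ) * (2 * 4 ^ (sP N).b * (sP N).v) := by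
        have : 0 < n + (hidH.m N - n) := Nat.pos_of_ne_zero (NeZero.ne _)
        have := H.s_pos; unfold entryMoment at this; positivity
      have hU := isColumnOrthonormal_uMat (sP N) hG hN₀ H.t_pos.le hsc.1 hsc.2.1
      have hE : eArr (sP N) IP W = roundEntries IP.b' (uMat (sP N) W) :=
        hiddenOf_entryArr_eq (sP N) IP.b' hG hN₀ H.t_pos.le hsc.1 hsc.2.1
      have hkβ : 0 < IP.kβ := by show 0 < hidH.kβ N; rw [hidH_kβ]; positivity
      have hbq : p₀.eval (n + (hidH.m N - n) + IP.kβ) ≤ IP.b' := by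
        show p₀.eval (n + (hidH.m N - n) + hidH.kβ N) ≤ hidH.bq p₀ N
        rw [HPolys.bq, ← he]
      have h := hO' n (hidH.m N - n) IP.b' IP.kβ (uMat (sP N) W) hU hkβ hbq
      rw [lawArr, hE]
      exact h.trans H.inv_kβ_le
    have hSt : ∀ (x : List Bool) (ℓ : ℕ), uniformProb (cS.eval (x.length + ℓ + hidH.kη N + hidH.kδS N))
        {u | ¬ IsApproxCount (hidH.kη N) (countWitnesses (samplerRel (oracleRandAlg O cO)) ℓ x)
          (countEstimate F x ℓ (hidH.kη N) (hidH.kδS N) u)} ≤ 1 / (hidH.kδS N : ℝ) := fun x ℓ =>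
      hS x ℓ _ _ (by rw [hidH_kη]; positivity) (by rw [hidH_kδS]; omega)
    have hkη : 0 < hidH.kη N := by rw [hidH_kη]; positivity
    have hδS : 0 < hidH.kδS N := by rw [hidH_kδS]; omega
    have herr := H.errTerm_le
    rw [he] at herr
    have hfail := card_fail_le hidH p₀ cO cS F O (b := precP.eval N) H.hN hn he
      (by rw [hLr]; exact hNr) (by rw [hLr]; exact hbr) H.t_pos hsc.1 hsc.2.1 hsc.2.2.1 hsc.2.2.2.1 H.Z_pos H.Pr_pos
      hε₀ hδ₀ hne hs rfl hkη hδS hO hSt hLU herr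
    rw [card_filter_prod_coins_congr hLr (fun x l => FailEv hidH p₀ cO cS F n (precP.eval N) kε kδ (rowsOfCoins (sP N) x) l)] at hfail
    -- the fractions and the cardinalities
    have hfrac := H.fractions_le (M4 := ∑ a, unifW (sP N) a * ‖yOf (sP N) a‖ ^ 4) (by unfold entryMoment; exact hM4le)
    rw [he] at hfrac
    have hcardA := card_entryBlock_pow (sP N) n
    have hcardΩ : (Fintype.card (IdealΩ IP (sP N) n (hidH.m N - n)) : ℝ) = 2 ^ ((coinP p₀ cO cS).eval N) := by
      rw [card_idealΩ IP (sP N) hm2]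
      show (2 : ℝ) ^ (n * hidH.μ N + (n + (hidH.m N - n)) * (n * (2 * (sP N).coinLen)) +
        ((coinP p₀ cO cS).eval N - (n * hidH.μ N + (n + (hidH.m N - n)) * (n * (2 * (sP N).coinLen))))) = _
      rw [hLr]
    have hF0 : 0 ≤ domF N ^ (2 * (n * n)) := pow_nonneg (domF_nonneg hN1) _
    have hF2 := domF_pow_le_two hn hnN
    have hkδ := H.kδ_real
    have h2pos : (0 : ℝ) < 2 ^ (n * (n * (2 * (sP N).coinLen))) := by positivity
    have hcard' : ((univ.filter fun q : List.Vector Bool (n * (n * (2 * (sP N).coinLen))) × List.Vector Bool ((coinP p₀ cO cS).eval N) =>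
        FailEv hidH p₀ cO cS F n (precP.eval N) kε kδ (rowsOfCoins (sP N) q.1) q.2.toList).card : ℝ) ≤
        2 ^ (n * (n * (2 * (sP N).coinLen))) * (6 / (16 * (kδ : ℝ)) * 2 ^ ((coinP p₀ cO cS).eval N)) := by
      refine hfail.trans ?_
      rw [hcardA, hcardΩ]
      refine mul_le_mul_of_nonneg_left ?_ (by positivity)
      exact mul_le_mul_of_nonneg_right (by unfold entryMoment at hfrac; exact hfrac) (by positivity)
    calc domF N ^ (2 * (n * n)) / 2 ^ (n * (n * (2 * (sP N).coinLen))) * _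
        ≤ domF N ^ (2 * (n * n)) / 2 ^ (n * (n * (2 * (sP N).coinLen))) *
            (2 ^ (n * (n * (2 * (sP N).coinLen))) * (6 / (16 * (kδ : ℝ)) * 2 ^ ((coinP p₀ cO cS).eval N))) :=
          mul_le_mul_of_nonneg_left hcard' (by positivity)
      _ = domF N ^ (2 * (n * n)) * (6 / (16 * (kδ : ℝ)) * 2 ^ ((coinP p₀ cO cS).eval N)) := by
          field_simp
      _ ≤ 2 * (6 / (16 * (kδ : ℝ)) * 2 ^ ((coinP p₀ cO cS).eval N)) := mul_le_mul_of_nonneg_right hF2 (by positivity)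
      _ = 12 / (16 * (kδ : ℝ)) * 2 ^ ((coinP p₀ cO cS).eval N) := by ring
  -- Step 5: assemble
  have h2L : (0 : ℝ) < 2 ^ ((coinP p₀ cO cS).eval N) := by positivity
  calc 2 ^ ((coinP p₀ cO cS).eval N) * (gaussianMatrixMeasure n).real {X | ∃ i j, 2 * (N : ℝ) < ‖X i j‖} + _
      ≤ 2 ^ ((coinP p₀ cO cS).eval N) * (1 / (16 * (kδ : ℝ))) +
          (2 ^ ((coinP p₀ cO cS).eval N) * (1 / (16 * (kδ : ℝ))) + 12 / (16 * (kδ : ℝ)) * 2 ^ ((coinP p₀ cO cS).eval N)) :=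
        add_le_add (mul_le_mul_of_nonneg_left htail1 h2L.le)
          (hdom.trans (add_le_add (mul_le_mul_of_nonneg_left htail2 h2L.le) hcount))
    _ = 14 / (16 * (kδ : ℝ)) * 2 ^ ((coinP p₀ cO cS).eval N) := by ring

/-- **Dimension `0`: the machine never fails** (it answers `4ᵇ`, and `|Per ∅|² = 1`). [folklore] -/
theorem gpeBadEv_dim_zero {kε kδ : ℕ} (hkε : 0 < kε) (r : List.Vector Bool ((coinP p₀ cO cS).eval (0 + kε + kδ))) :
    (gaussianMatrixMeasure 0).real {X | GPEBadEv p₀ cO cS F 0 kε kδ (0 + kε + kδ) X r.toList} = 0 := by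
  have hempty : {X : Fin 0 → Fin 0 → ℂ | GPEBadEv p₀ cO cS F 0 kε kδ (0 + kε + kδ) X r.toList} = ∅ := by
    ext X
    simp only [Set.mem_setOf_eq, Set.mem_empty_iff_false, iff_false, GPEBadEv, not_lt]
    rw [gpeRandOracleEstimate_gpeSolver, postFun]
    have hb : precP.eval (0 + kε + kδ) ≤ r.toList.length := by
      rw [r.toList_length]; exact (coin_fields (p₀ := p₀) (cO := cO) (cS := cS) (Nat.zero_le (0 + kε + kδ))).2.2.2
    have hnC : GIn.nC ((0 : ℕ), precP.eval (0 + kε + kδ), kε, kδ, rowsOf (roundMatrix (precP.eval (0 + kε + kδ)) (Matrix.of X)))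
        r.toList = 0 := by unfold GIn.nC; exact Nat.zero_min _
    have hbC : GIn.bC ((0 : ℕ), precP.eval (0 + kε + kδ), kε, kδ, rowsOf (roundMatrix (precP.eval (0 + kε + kδ)) (Matrix.of X)))
        r.toList = precP.eval (0 + kε + kδ) := GIn.bC_eq hb
    simp only [hnC, if_true, hbC, permanent_isEmpty, norm_one, one_pow]
    push_cast
    rw [div_self (by positivity), sub_self, abs_zero]
    positivity
  rw [hempty, measureReal_empty]

/-- **Aaronson–Arkhipov, Thm. 1.3 (the tree's named fact, DISCHARGED).** For every approximate
BosonSampling oracle `𝒪` in the sense of Def. 3.11, `|GPE|²_± ∈ FBPP^{NP^𝒪}`: there are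
`L ∈ NP^𝒪` and a polynomial-time oracle transducer `M ∈ FP^{L}` which, on the GPE query
`⟨n, b, kε, kδ, X̃⟩` with its coins appended, answers `z` with `|z/4ᵇ - |Per X|²| ≤ n!/kε`
except with probability `< 1/kδ` jointly over `X ∼ 𝒩(0,1)_ℂ^{n×n}` and the coins (`b = 16(N+1)²`,
`N = n + kε + kδ`, polynomially many coins). [cite: AaronsonArkhipovToC2013, Thm. 1.3 (p. 152; proof §5.2 pp. 192–195)] -/
theorem gpeSolvableInFBPPRel_NPRel_of_approxBosonSamplingOracle_holds :
    gpeSolvableInFBPPRel_NPRel_of_approxBosonSamplingOracle := by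
  intro O hO
  obtain ⟨p₀, cO, hO'⟩ := hO
  obtain ⟨L, hL, F, hF, cS, hS⟩ := exists_stockmeyer_counter_samplerRel StockMachine.stockmeyerApproxCounting_holds O cO
  refine ⟨L, hL, gpeSolver hidH p₀ cO cS F, gpeSolver_mem_FPRel hidH p₀ cO cS F hF, precP, coinP p₀ cO cS, ?_⟩
  intro n kε kδ hkε hkδ
  change (∑ r : List.Vector Bool ((coinP p₀ cO cS).eval (n + kε + kδ)),
      (gaussianMatrixMeasure n).real {X | GPEBadEv p₀ cO cS F n kε kδ (n + kε + kδ) X r.toList}) /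
      2 ^ ((coinP p₀ cO cS).eval (n + kε + kδ)) < 1 / (kδ : ℝ)
  have h2 : (0 : ℝ) < 2 ^ ((coinP p₀ cO cS).eval (n + kε + kδ)) := by positivity
  have hkδ' : (0 : ℝ) < kδ := by exact_mod_cast hkδ
  rw [div_lt_iff₀ h2]
  rcases Nat.eq_zero_or_pos n with hn0 | hn
  · subst hn0
    rw [Finset.sum_eq_zero fun r _ => gpeBadEv_dim_zero p₀ cO cS F hkε r]
    positivity
  · have H : HidingHyp n kε kδ (n + kε + kδ) := ⟨hn, hkε, hkδ, rfl⟩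
    refine (sum_gpeBadEv_le p₀ cO cS F O hO' hS H).trans_lt (mul_lt_mul_of_pos_right ?_ h2)
    rw [div_lt_div_iff₀ (by positivity) hkδ']
    nlinarith

end Main

end Literature.Computability.QuantumComplexity
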